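import Summits.ValiantsHypothesis.ValiantsHypothesis.Theses.RyserTripartition
import Literature.Combinatorics.Enumerative.PermanentLaplaceExpansionThreeBlocks
import HarnessLib

/-!
# ValiantsHypothesis / RyserTripartition — item `PerLeTripartition` (stmt-ValiantsHypothesis-11286):
# the three-row-block Laplace expansion of a `3k × 3k` permanent in the tripartition indexing

Support brick for `PerLeTripartition` (the bridge "a circuit for the tripartition polynomial
`T_k = Σ_{S,T,U pairwise disjoint k-sets} X(0,S) X(1,T) X(2,U)` yields a syntactically multilinear
circuit for `per_{3k}`"): the algebraic identity behind the substitution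
`X(i, S) ↦ per(rows of block i, columns S)`.  For ANY `3k × 3k` matrix `A` over a commutative
semiring, with the row blocks `B₀ = {r < k}`, `B₁ = {k ≤ r < 2k}` and third block `(B₀ ∪ B₁)ᶜ`,

  `per A = Σ_{S} Σ_{T} Σ_{U} [S, T, U pairwise disjoint] · q₀(S) · q₁(T) · q₂(U)`

summed over ALL triples of `k`-subsets of the columns EXACTLY as in the route's `T_k`
(`{A : Finset (Fin (3k)) // A.card = k}`, indicator `Disjoint S T ∧ Disjoint S U ∧ Disjoint T U`),
where `q_i(S) = Σ_{b : B_i ≃ S} ∏_{p ∈ B_i} A p (b p)` is the sign-free bijection sum (= the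
`k × k` sub-permanent on rows `B_i`, columns `S`, by
`Literature.Combinatorics.Enumerative.sum_equiv_prod_eq_permanent_submatrix`).  So evaluating
`T_k` at `X(i,S) := q_i(S)` gives `per A` (`eval_tripartition_eq_permanent`), in particular
`per_{3k} = perPoly (Fin (3k))` for `A` the generic matrix.

Source: the three-block Laplace expansion
`Literature.Combinatorics.Enumerative.permanent_eq_sum_sum_threeBlocks` (Minc, *Permanents*, Ch. 2
Thm. 1.2); here only the re-indexing (the third column block is forced to be `(S ∪ T)ᶜ` by
cardinality).  HONEST FRAMING: bookkeeping toward a support item of a dormant route; nothing here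
bears on `VP ≠ VNP`, which is NOT proved.
-/

-- layout Summits/ValiantsHypothesis/ValiantsHypothesis forces the duplicated namespace component
set_option linter.dupNamespace false

namespace Summit.ValiantsHypothesis.ValiantsHypothesis.Theorems.RyserTripartition

open Finset Matrix Literature.Combinatorics.Enumerative

variable {R : Type*} [CommSemiring R]

/-- The two first row blocks `B₀ = {r < k}` and `B₁ = {k ≤ r < 2k}` of `Fin (3k)` are disjoint.
[folklore] -/
theorem disjoint_rowBlocks (k : ℕ) :
    Disjoint ((Finset.univ : Finset (Fin (3 * k))).filter fun r : Fin (3 * k) => (r : ℕ) < k)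
      ((Finset.univ : Finset (Fin (3 * k))).filter fun r : Fin (3 * k) => k ≤ (r : ℕ) ∧ (r : ℕ) < 2 * k) := by
  rw [Finset.disjoint_filter]
  intro r _ h1 h2
  omega

/-- The row blocks have `k` elements each: `|B₀| = k`. [folklore] -/
theorem card_rowBlock₀ (k : ℕ) :
    ((Finset.univ : Finset (Fin (3 * k))).filter fun r : Fin (3 * k) => (r : ℕ) < k).card = k := by
  have h : ((Finset.univ : Finset (Fin (3 * k))).filter fun r : Fin (3 * k) => (r : ℕ) < k) =
      (Finset.univ : Finset (Fin k)).map (Fin.castLEEmb (by omega : k ≤ 3 * k)) := by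
    ext r
    simp only [Finset.mem_filter, Finset.mem_univ, true_and, Finset.mem_map, Fin.castLEEmb_apply]
    constructor
    · intro hr; exact ⟨⟨r, hr⟩, by ext; simp⟩
    · rintro ⟨s, rfl⟩; simp [Fin.castLE]
  rw [h, Finset.card_map, Finset.card_univ, Fintype.card_fin]

/-- `|B₁| = k`. [folklore] -/
theorem card_rowBlock₁ (k : ℕ) :
    ((Finset.univ : Finset (Fin (3 * k))).filter fun r : Fin (3 * k) => k ≤ (r : ℕ) ∧ (r : ℕ) < 2 * k).card = k := by
  have h : ((Finset.univ : Finset (Fin (3 * k))).filter fun r : Fin (3 * k) => k ≤ (r : ℕ) ∧ (r : ℕ) < 2 * k) =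
      (Finset.univ : Finset (Fin k)).map
        ⟨fun s : Fin k => (⟨k + s, by omega⟩ : Fin (3 * k)), fun s t h => by
          simp only [Fin.mk.injEq] at h; exact Fin.ext (by omega)⟩ := by
    ext r
    simp only [Finset.mem_filter, Finset.mem_univ, true_and, Finset.mem_map,
      Function.Embedding.coeFn_mk]
    constructor
    · rintro ⟨h1, h2⟩; exact ⟨⟨r - k, by omega⟩, by ext; simp; omega⟩
    · rintro ⟨s, rfl⟩; simp; omega
  rw [h, Finset.card_map, Finset.card_univ, Fintype.card_fin]

/-- In `Fin (3k)`: a `k`-set disjoint from two disjoint `k`-sets `S, T` is the complement of `S ∪ T`.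
[folklore] -/
theorem eq_compl_union_of_disjoint {k : ℕ} {S T U : Finset (Fin (3 * k))} (hS : S.card = k)
    (hT : T.card = k) (hU : U.card = k) (hST : Disjoint S T) (hSU : Disjoint S U)
    (hTU : Disjoint T U) : U = (S ∪ T)ᶜ := by
  symm
  apply Finset.eq_of_superset_of_card_ge
  · intro x hx
    rw [Finset.mem_compl, Finset.mem_union, not_or]
    exact ⟨fun h => Finset.disjoint_left.mp hSU h hx, fun h => Finset.disjoint_left.mp hTU h hx⟩
  · rw [Finset.card_compl, Fintype.card_fin, Finset.card_union_of_disjoint hST, hS, hT, hU]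
    omega

/-- **Three-row-block Laplace expansion in the tripartition indexing.** For every `3k × 3k` matrix
`A` over a commutative semiring, `per A = Σ_{S,T,U} [pairwise disjoint] q₀(S) q₁(T) q₂(U)`, the sum
over all triples of `k`-subsets of `Fin (3k)` exactly as in the route's `T_k`, with the block
bijection sums `q_i`. [folklore] -/
theorem permanent_eq_sum_tripartition (k : ℕ) (A : Matrix (Fin (3 * k)) (Fin (3 * k)) R) :
    A.permanent =
      ∑ S : {A : Finset (Fin (3 * k)) // A.card = k}, ∑ T : {A : Finset (Fin (3 * k)) // A.card = k},
        ∑ U : {A : Finset (Fin (3 * k)) // A.card = k},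
          if Disjoint S.1 T.1 ∧ Disjoint S.1 U.1 ∧ Disjoint T.1 U.1 then
            (∑ b : ↥((Finset.univ : Finset (Fin (3 * k))).filter fun r : Fin (3 * k) => (r : ℕ) < k) ≃ ↥S.1,
                ∏ p : ↥((Finset.univ : Finset (Fin (3 * k))).filter fun r : Fin (3 * k) => (r : ℕ) < k),
                  A p (b p)) *
              (∑ b : ↥((Finset.univ : Finset (Fin (3 * k))).filter
                    fun r : Fin (3 * k) => k ≤ (r : ℕ) ∧ (r : ℕ) < 2 * k) ≃ ↥T.1,
                ∏ p : ↥((Finset.univ : Finset (Fin (3 * k))).filter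
                    fun r : Fin (3 * k) => k ≤ (r : ℕ) ∧ (r : ℕ) < 2 * k), A p (b p)) *
              (∑ b : ↥((((Finset.univ : Finset (Fin (3 * k))).filter fun r : Fin (3 * k) => (r : ℕ) < k) ∪
                    ((Finset.univ : Finset (Fin (3 * k))).filter
                      fun r : Fin (3 * k) => k ≤ (r : ℕ) ∧ (r : ℕ) < 2 * k))ᶜ) ≃ ↥U.1,
                ∏ p : ↥((((Finset.univ : Finset (Fin (3 * k))).filter fun r : Fin (3 * k) => (r : ℕ) < k) ∪
                    ((Finset.univ : Finset (Fin (3 * k))).filter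
                      fun r : Fin (3 * k) => k ≤ (r : ℕ) ∧ (r : ℕ) < 2 * k))ᶜ), A p (b p))
          else 0 := by
  classical
  rw [permanent_eq_sum_sum_threeBlocks A (disjoint_rowBlocks k), card_rowBlock₀, card_rowBlock₁]
  -- abbreviate the three block sums as functions of the column sets
  set q₀ : Finset (Fin (3 * k)) → R := fun S =>
    ∑ b : ↥((Finset.univ : Finset (Fin (3 * k))).filter fun r : Fin (3 * k) => (r : ℕ) < k) ≃ ↥S,
      ∏ p : ↥((Finset.univ : Finset (Fin (3 * k))).filter fun r : Fin (3 * k) => (r : ℕ) < k), A p (b p) with hq₀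
  set q₁ : Finset (Fin (3 * k)) → R := fun T =>
    ∑ b : ↥((Finset.univ : Finset (Fin (3 * k))).filter
        fun r : Fin (3 * k) => k ≤ (r : ℕ) ∧ (r : ℕ) < 2 * k) ≃ ↥T,
      ∏ p : ↥((Finset.univ : Finset (Fin (3 * k))).filter
        fun r : Fin (3 * k) => k ≤ (r : ℕ) ∧ (r : ℕ) < 2 * k), A p (b p) with hq₁
  set q₂ : Finset (Fin (3 * k)) → R := fun U =>
    ∑ b : ↥((((Finset.univ : Finset (Fin (3 * k))).filter fun r : Fin (3 * k) => (r : ℕ) < k) ∪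
        ((Finset.univ : Finset (Fin (3 * k))).filter fun r : Fin (3 * k) => k ≤ (r : ℕ) ∧ (r : ℕ) < 2 * k))ᶜ) ≃ ↥U,
      ∏ p : ↥((((Finset.univ : Finset (Fin (3 * k))).filter fun r : Fin (3 * k) => (r : ℕ) < k) ∪
        ((Finset.univ : Finset (Fin (3 * k))).filter fun r : Fin (3 * k) => k ≤ (r : ℕ) ∧ (r : ℕ) < 2 * k))ᶜ),
        A p (b p) with hq₂
  change ∑ S ∈ Finset.univ.powersetCard k, ∑ T ∈ (Finset.univ.powersetCard k).filter
      (fun T => Disjoint S T), q₀ S * q₁ T * q₂ (S ∪ T)ᶜ =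
    ∑ S : {A : Finset (Fin (3 * k)) // A.card = k}, ∑ T : {A : Finset (Fin (3 * k)) // A.card = k},
      ∑ U : {A : Finset (Fin (3 * k)) // A.card = k},
        if Disjoint S.1 T.1 ∧ Disjoint S.1 U.1 ∧ Disjoint T.1 U.1 then q₀ S.1 * q₁ T.1 * q₂ U.1
        else 0
  -- pass from sums over the subtype of `k`-sets to sums over `powersetCard k univ`
  have hmem : ∀ S : Finset (Fin (3 * k)),
      S ∈ (Finset.univ : Finset (Fin (3 * k))).powersetCard k ↔ S.card = k := fun S => by
    simp [Finset.mem_powersetCard]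
  have key : ∀ g : Finset (Fin (3 * k)) → Finset (Fin (3 * k)) → Finset (Fin (3 * k)) → R,
      (∑ S : {A : Finset (Fin (3 * k)) // A.card = k}, ∑ T : {A : Finset (Fin (3 * k)) // A.card = k},
        ∑ U : {A : Finset (Fin (3 * k)) // A.card = k}, g S.1 T.1 U.1) =
        ∑ S ∈ (Finset.univ : Finset (Fin (3 * k))).powersetCard k,
          ∑ T ∈ (Finset.univ : Finset (Fin (3 * k))).powersetCard k,
            ∑ U ∈ (Finset.univ : Finset (Fin (3 * k))).powersetCard k, g S T U := by
    intro g
    refine ((Finset.sum_subtype _ hmem fun S => ∑ T : {A : Finset (Fin (3 * k)) // A.card = k},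
      ∑ U : {A : Finset (Fin (3 * k)) // A.card = k}, g S T.1 U.1).symm).trans ?_
    refine Finset.sum_congr rfl fun S _ => ?_
    refine ((Finset.sum_subtype _ hmem fun T =>
      ∑ U : {A : Finset (Fin (3 * k)) // A.card = k}, g S T U.1).symm).trans ?_
    refine Finset.sum_congr rfl fun T _ => ?_
    exact (Finset.sum_subtype _ hmem fun U => g S T U).symm
  symm
  refine (key (fun S T U => if Disjoint S T ∧ Disjoint S U ∧ Disjoint T U then
    q₀ S * q₁ T * q₂ U else 0)).trans ?_
  refine Finset.sum_congr rfl fun S hS => ?_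
  rw [Finset.sum_filter]
  refine Finset.sum_congr rfl fun T hT => ?_
  have hSk : S.card = k := (Finset.mem_powersetCard.mp hS).2
  have hTk : T.card = k := (Finset.mem_powersetCard.mp hT).2
  by_cases hST : Disjoint S T
  · rw [if_pos hST]
    -- the third set is forced to be `(S ∪ T)ᶜ`
    have hcard : ((S ∪ T)ᶜ).card = k := by
      rw [Finset.card_compl, Fintype.card_fin, Finset.card_union_of_disjoint hST, hSk, hTk]; omega
    rw [Finset.sum_eq_single_of_mem ((S ∪ T)ᶜ) ((hmem _).2 hcard)]
    · rw [if_pos]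
      exact ⟨hST, Finset.disjoint_left.mpr fun x hx hx' =>
          (Finset.mem_compl.mp hx') (Finset.mem_union_left _ hx),
        Finset.disjoint_left.mpr fun x hx hx' =>
          (Finset.mem_compl.mp hx') (Finset.mem_union_right _ hx)⟩
    · intro U hU hne
      rw [if_neg]
      rintro ⟨_, hSU, hTU⟩
      exact hne (eq_compl_union_of_disjoint hSk hTk ((hmem U).1 hU) hST hSU hTU)
  · rw [if_neg hST]
    exact Finset.sum_eq_zero fun U _ => by rw [if_neg (fun h => hST h.1)]

/-- **Evaluating the tripartition polynomial at the block sub-permanents gives the permanent.**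
For a `3k × 3k` matrix `A` with entries in a commutative `R`-algebra `P`, substituting
`X(i, S) ↦ q_i(S)` (the block bijection sums of `permanent_eq_sum_tripartition`, packed as
`![q₀, q₁, q₂]`) into the route's `T_k = Σ_{S,T,U} [pairwise disjoint] X(0,S) X(1,T) X(2,U)` yields
`per A`; with `A` the generic matrix this is `perPoly (Fin (3k))`. This is the algebraic half of the
bridge `PerLeTripartition`. [folklore] -/
theorem aeval_tripartition_eq_permanent (k : ℕ) {P : Type*} [CommSemiring P] [Algebra R P]
    (A : Matrix (Fin (3 * k)) (Fin (3 * k)) P) :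
    MvPolynomial.aeval (fun v : Fin 3 × {A : Finset (Fin (3 * k)) // A.card = k} =>
        (![fun S : Finset (Fin (3 * k)) =>
              ∑ b : ↥((Finset.univ : Finset (Fin (3 * k))).filter fun r : Fin (3 * k) => (r : ℕ) < k) ≃ ↥S,
                ∏ p : ↥((Finset.univ : Finset (Fin (3 * k))).filter fun r : Fin (3 * k) => (r : ℕ) < k),
                  A p (b p),
            fun T : Finset (Fin (3 * k)) =>
              ∑ b : ↥((Finset.univ : Finset (Fin (3 * k))).filter
                    fun r : Fin (3 * k) => k ≤ (r : ℕ) ∧ (r : ℕ) < 2 * k) ≃ ↥T,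
                ∏ p : ↥((Finset.univ : Finset (Fin (3 * k))).filter
                    fun r : Fin (3 * k) => k ≤ (r : ℕ) ∧ (r : ℕ) < 2 * k), A p (b p),
            fun U : Finset (Fin (3 * k)) =>
              ∑ b : ↥((((Finset.univ : Finset (Fin (3 * k))).filter
                      fun r : Fin (3 * k) => (r : ℕ) < k) ∪
                    ((Finset.univ : Finset (Fin (3 * k))).filter
                      fun r : Fin (3 * k) => k ≤ (r : ℕ) ∧ (r : ℕ) < 2 * k))ᶜ) ≃ ↥U,
                ∏ p : ↥((((Finset.univ : Finset (Fin (3 * k))).filter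
                      fun r : Fin (3 * k) => (r : ℕ) < k) ∪
                    ((Finset.univ : Finset (Fin (3 * k))).filter
                      fun r : Fin (3 * k) => k ≤ (r : ℕ) ∧ (r : ℕ) < 2 * k))ᶜ), A p (b p)] :
          Fin 3 → Finset (Fin (3 * k)) → P) v.1 v.2.1)
      (∑ S : {A : Finset (Fin (3 * k)) // A.card = k}, ∑ T : {A : Finset (Fin (3 * k)) // A.card = k},
        ∑ U : {A : Finset (Fin (3 * k)) // A.card = k},
          if Disjoint S.1 T.1 ∧ Disjoint S.1 U.1 ∧ Disjoint T.1 U.1 then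
            (MvPolynomial.X (0, S) * MvPolynomial.X (1, T) * MvPolynomial.X (2, U) :
              MvPolynomial (Fin 3 × {A : Finset (Fin (3 * k)) // A.card = k}) R)
          else 0) = A.permanent := by
  rw [permanent_eq_sum_tripartition k A, map_sum]
  refine Finset.sum_congr rfl fun S _ => ?_
  rw [map_sum]
  refine Finset.sum_congr rfl fun T _ => ?_
  rw [map_sum]
  refine Finset.sum_congr rfl fun U _ => ?_
  split_ifs
  · simp only [map_mul, MvPolynomial.aeval_X, Matrix.cons_val_zero, Matrix.cons_val_one]
    rfl
  · exact map_zero _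

end Summit.ValiantsHypothesis.ValiantsHypothesis.Theorems.RyserTripartition
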